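/-
Copyright (c) 2026 the pub-hodgecm-mathlib formalisation cell (harness21).  Prover seat hodgecm-mathlib-A-p16 (g29), architect of road «S3-tree»
(ruling A-57 (a) S-c), 2026-09-01.
-/
import Literature.NumberTheory.Automorphic.UnitaryLatticeTreeFixedVertexCharpoly        -- ★∕filed A-p16 (g29) S-a FILE 2: `exists_isVertex_mapGL_eq_of_charpoly` (brings T1a∕T1b, FILE 0∕1)
import Literature.NumberTheory.Automorphic.UnitaryLatticeTreeStabilizer                 -- ★ F0P2-p02 (g10) T2 FILE 0: `mapGL_latt_eq_latt_iff`
import Literature.NumberTheory.Rogawski1990.RankOneKappaVertexCoverCM                    -- ★ A-p16 (g27): `isCompact_isOpen_conjGlInt_subgroupOf_unitary`, `Literature.GroupTheory.isOpen_coe_comap_of_continuous` …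
import Literature.NumberTheory.Automorphic.UnitaryGroupInertPlaceHyperbolicBasis          -- ★ `placeForm_hermitian_of_smul_eq`
import Literature.NumberTheory.Automorphic.Liu2021.FinAdelicCheckSurjective               -- ★ `galAdicCompletionMap_galAdicCompletionMap_self`
import Literature.NumberTheory.Automorphic.AdicCompletionCompact                          -- ★ DVR pattern for `𝒪[L_w]`
import HarnessLib

/-!
# Every element of `U(H′)(L⁺_v)` with `w`-integral characteristic polynomial lies in the (compact open) stabiliser of a VERTEX of the `U(H′)_w` lattice tree
# (the CM dress of the fixed-vertex lemma; Bruhat–Tits 1972 §10, Serre *Trees* II.1.3, Rogawski 1990 §4.9)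

Topic `NumberTheory/Rogawski1990`; namespace `Literature.NumberTheory.Rogawski1990`.  THEOREMS ONLY (no definition, no instance, no notation, no named fact, no
`sorry`); kernel lane.  Cell `pub/hodgecm-mathlib` (D-0151), crux H413 = `stmt-HodgeConjecture-24833`, road «S3-tree» (LEAD F0P3a-plan (g11) WORD T10-2), END CONTRACT
(F0P3a-p03 (g14) v2 8bf60abf) stub «SPAN», architect ruling A-57 (a) brick **S-c «ASSEMBLY»**, FILE A = THE VERTEX-STABILISER COVER at a non-split place `v` of `L⁺`
(one place `w` of the CM field `L` above it), in the `cmDatum` currency of the letter: the generic fixed-vertex lemma ★ `UnitaryLatticeTree.exists_isVertex_mapGL_eq_of_charpoly`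
instantiated at `K = L_w`, `σ = σ_w`, `H = H′_w`, transported along the one-place model ★ `localNonsplitEquiv : U(H′)(L⁺_v) ≃ₜ* U(σ_w, H′_w)(L_w)`.
HONEST LABEL: HC_CM is proved only modulo the printed citations until rung 0 closes; this file pays no letter (it is the `U(3)` twin of ★ `RankOneKappaVertexCoverCM`).

THE MATHEMATICS.  `v` non-split in `L ∕ L⁺` (`c • w = w`), `e : U(H′)(L⁺_v) ≃ₜ* U_w := U(σ_w, H′_w)(L_w) ≤ GL_N(L_w)` the one-place model (entries evaluated at `w`).
(§1) At `w`: `σ_w` is an involution preserving `Valued.v`; `H′_w = placeForm H′ w` is `σ_w`-hermitian and invertible when `H′` is `c`-hermitian with `det H′ ≠ 0`;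
`𝒪[L_w]` is a principal ideal ring; `L_w` has a uniformiser.  (§2) For a frame `g ∈ GL_N(L_w)`, the STABILISER `K_g := e⁻¹(U_w ∩ g·GL_N(𝒪_w)·g⁻¹)` of the lattice
`latt g = g·𝒪_w^N` is a compact open subgroup of `U(H′)(L⁺_v)` (★ `isCompact_isOpen_conjGlInt_subgroupOf_unitary`), and `u ∈ K_g ↔ e(u)·latt g = latt g`
(★ `mapGL_latt_eq_latt_iff` + ★ `mem_glInt_iff` + the valuation bridge ★ `SemiLocal.valuation_le_one_iff_valued_le_one`).  (§3) THE COVER: if the characteristic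
polynomial of `e(δ)` (= that of `δ`, read at `w`) has `w`-integral coefficients then `δ ∈ K_g` for a frame `g` with `latt g` a VERTEX of the tree of `(L_w^N, H′_w)`
(★ S-a FILE 2 `exists_isVertex_mapGL_eq_of_charpoly`).

* §1 `isUnit_det_placeForm`, `placeForm_map_transpose_of_hermitian`, `galAdicCompletionMap_involutive`, `isPrincipalIdealRing_integer_adicCompletion`, `exists_uniformizer_adicCompletion`.
* §2 **`exists_vertexStabilizer`** — `∀ g, ∃ K : Subgroup (U(H′)(L⁺_v)), IsCompact K ∧ IsOpen K ∧ ∀ u, u ∈ K ↔ mapGL (e u) (latt g) = latt g`.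
* §3 **`exists_isVertex_mapGL_localNonsplitEquiv_eq_of_charpoly`** (a fixed vertex) and **`exists_vertexStabilizer_mem_of_charpoly`** (δ lies in a compact open vertex stabiliser).

## References
* [BruhatTits1972] F. Bruhat, J. Tits, *Groupes réductifs sur un corps local I*, Publ. Math. IHÉS 41 (1972): §10.
* [Serre1980Trees] J.-P. Serre, *Trees* (1980): Ch. II §1.3.
* [Rogawski1990] J. D. Rogawski, *Automorphic Representations of Unitary Groups in Three Variables* (1990): §4.9 p. 54, Lemma 4.9.3 p. 56.
* [PlatonovRapinchuk1994] V. Platonov, A. Rapinchuk, *Algebraic Groups and Number Theory* (1994): §5.1, §3.3.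
-/

set_option autoImplicit false

noncomputable section

open scoped Valued WithZero Matrix MatrixGroups
open Topology Set Function NumberField IsDedekindDomain Matrix

namespace Literature.NumberTheory.Rogawski1990

open Literature.NumberTheory.Automorphic Literature.NumberTheory.Automorphic.UnitaryGroup Literature.NumberTheory.GaloisRepresentations
open Literature.NumberTheory.Automorphic.UnitaryLatticeTree Literature.NumberTheory.Automorphic.HermitianLattice

variable (L : Type) [Field L] [NumberField L] [IsCMField L] (v : HeightOneSpectrum (𝓞 ↥(maximalRealSubfield L)))
  (w : PlacesOver L v) (hw : IsCMField.complexConj L • w.1 = w.1)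

/-! ## §1 The data at `w`: involution, hermitian invertible form, principal valuation ring, uniformiser -/

section Data

variable {N : ℕ} (H' : Matrix (Fin N) (Fin N) L)

omit [IsCMField L] hw in
/-- `det H′ ≠ 0 ⟹ det H′_w` is a unit of `L_w`. [cite: PlatonovRapinchuk1994, §5.1] -/
theorem isUnit_det_placeForm (hdet' : H'.det ≠ 0) : IsUnit (placeForm H' w.1).det :=
  (Matrix.isUnit_iff_isUnit_det _).1 (isUnit_placeForm_of_isUnit_det (J := H') (isUnit_iff_ne_zero.2 hdet') w.1)

/-- `H′` `c`-hermitian ⟹ `H′_w` is `σ_w`-hermitian. [cite: PlatonovRapinchuk1994, §5.1] -/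
theorem placeForm_map_transpose_of_hermitian (hH' : (H'.map (cmConjRingHom L))ᵀ = H') :
    ((placeForm H' w.1).map (galAdicCompletionMap (L := L) (IsCMField.complexConj L) hw))ᵀ = placeForm H' w.1 :=
  placeForm_hermitian_of_smul_eq (c := IsCMField.complexConj L) w H' hH' hw

/-- `σ_w` is an involution of `L_w` (`c² = 1`). [cite: PlatonovRapinchuk1994, §5.1] -/
theorem galAdicCompletionMap_involutive (a : w.1.adicCompletion L) :
    galAdicCompletionMap (L := L) (IsCMField.complexConj L) hw (galAdicCompletionMap (L := L) (IsCMField.complexConj L) hw a) = a :=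
  Liu2021.galAdicCompletionMap_galAdicCompletionMap_self (↥(maximalRealSubfield L)) L (IsCMField.complexConj L)
    (AlgEquiv.ext fun x => IsCMField.complexConj_apply_apply L x) hw a

omit [IsCMField L] hw in
/-- `𝒪[L_w]` (Mathlib's `Valued.integer`) is a principal ideal ring: it is the DVR `w.adicCompletionIntegers L`. [cite: SerreLocalFields1979, Ch. II §2] -/
theorem isPrincipalIdealRing_integer_adicCompletion : IsPrincipalIdealRing 𝒪[w.1.adicCompletion L] := by
  haveI : IsDiscreteValuationRing 𝒪[w.1.adicCompletion L] := inferInstanceAs (IsDiscreteValuationRing (w.1.adicCompletionIntegers L))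
  infer_instance

omit [IsCMField L] hw in
/-- `L_w` has a uniformiser: `∃ ϖ, |ϖ| = exp(−1)`. [cite: SerreLocalFields1979, Ch. II §2] -/
theorem exists_uniformizer_adicCompletion : ∃ ϖ : w.1.adicCompletion L, Valued.v ϖ = WithZero.exp (-1 : ℤ) := by
  obtain ⟨π, hπ⟩ := w.1.valuation_exists_uniformizer L
  exact ⟨(π : w.1.adicCompletion L), by rw [HeightOneSpectrum.valuedAdicCompletion_eq_valuation', hπ]⟩

end Data

/-! ## §2 The stabiliser of a framed lattice, pulled back to `U(H′)(L⁺_v)`: compact, open, and the membership test -/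

section Stabilizer

variable {N : ℕ} (H' : Matrix (Fin N) (Fin N) L)

omit [IsCMField L] in
/-- Integrality in the two currencies: `ValuativeRel` membership in `𝒪` of all entries ↔ `IsIntMatrix` for `Valued.v`. [cite: SerreLocalFields1979, Ch. II §1] -/
theorem forall_mem_integer_iff_isIntMatrix (A : Matrix (Fin N) (Fin N) (w.1.adicCompletion L)) :
    (∀ i j, A i j ∈ (ValuativeRel.valuation (w.1.adicCompletion L)).integer) ↔ IsIntMatrix A := by
  refine forall_congr' fun i => forall_congr' fun j => ?_
  rw [Valuation.mem_integer_iff, SemiLocal.valuation_le_one_iff_valued_le_one]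

/-- **THE VERTEX STABILISER `K_g`** of the framed lattice `latt g` (`g ∈ GL_N(L_w)`), pulled back along the one-place model `e`: a COMPACT OPEN subgroup of
`U(H′)(L⁺_v)` with `u ∈ K_g ↔ e(u)·latt g = latt g` (namely `K_g = e⁻¹(U_w ∩ g·GL_N(𝒪_w)·g⁻¹)`).
[cite: BruhatTits1972, §10] [cite: Serre1980Trees, Ch. II §1.3] [cite: PlatonovRapinchuk1994, §3.3] -/
theorem exists_vertexStabilizer (g : GL (Fin N) (w.1.adicCompletion L)) :
    ∃ K : Subgroup ((cmDatum L N H').Local v),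
      IsCompact (K : Set ((cmDatum L N H').Local v)) ∧ IsOpen (K : Set ((cmDatum L N H').Local v)) ∧
      ∀ u : (cmDatum L N H').Local v, u ∈ K ↔
        mapGL ((localNonsplitEquiv (IsCMField.complexConj L) H' (IsCMField.complexConj_ne_one L) w hw u :
            ↥(unitaryGroupOfForm (galAdicCompletionMap (L := L) (IsCMField.complexConj L) hw) (placeForm H' w.1))) :
          GL (Fin N) (w.1.adicCompletion L)) (latt (g : Matrix (Fin N) (Fin N) (w.1.adicCompletion L))) =
          latt (g : Matrix (Fin N) (Fin N) (w.1.adicCompletion L)) := by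
  set E := localNonsplitEquiv (IsCMField.complexConj L) H' (IsCMField.complexConj_ne_one L) w hw with hE
  have hK1 := isCompact_isOpen_conjGlInt_subgroupOf_unitary L v w hw (placeForm H' w.1) g
  refine ⟨((((glInt N (w.1.adicCompletion L)).map (MulAut.conj g).toMonoidHom).subgroupOf
      (unitaryGroupOfForm (galAdicCompletionMap (L := L) (IsCMField.complexConj L) hw) (placeForm H' w.1))).comap E.toMulEquiv.toMonoidHom),
    Literature.GroupTheory.isCompact_coe_comap_continuousMulEquiv E _ hK1.1,
    Literature.GroupTheory.isOpen_coe_comap_of_continuous E.toMulEquiv.toMonoidHom E.continuous _ hK1.2, fun u => ?_⟩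
  rw [Subgroup.mem_comap, Subgroup.mem_subgroupOf, mapGL_latt_eq_latt_iff]
  change ((E u : ↥(unitaryGroupOfForm (galAdicCompletionMap (L := L) (IsCMField.complexConj L) hw) (placeForm H' w.1))) : GL (Fin N) (w.1.adicCompletion L)) ∈
      (glInt N (w.1.adicCompletion L)).map (MulAut.conj g).toMonoidHom ↔ _
  set x : GL (Fin N) (w.1.adicCompletion L) := ((E u : ↥(unitaryGroupOfForm (galAdicCompletionMap (L := L) (IsCMField.complexConj L) hw) (placeForm H' w.1))) :
      GL (Fin N) (w.1.adicCompletion L)) with hx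
  -- `x ∈ g GL(𝒪) g⁻¹ ↔ g⁻¹ x g ∈ GL(𝒪)`
  have hmem : x ∈ (glInt N (w.1.adicCompletion L)).map (MulAut.conj g).toMonoidHom ↔ g⁻¹ * x * g ∈ glInt N (w.1.adicCompletion L) := by
    constructor
    · rintro ⟨y, hy, hyx⟩
      have : g⁻¹ * x * g = y := by
        rw [← hyx]
        change g⁻¹ * (g * y * g⁻¹) * g = y
        group
      rw [this]; exact hy
    · intro h
      refine ⟨g⁻¹ * x * g, h, ?_⟩
      change g * (g⁻¹ * x * g) * g⁻¹ = x
      group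
  rw [hmem, mem_glInt_iff, forall_mem_integer_iff_isIntMatrix, forall_mem_integer_iff_isIntMatrix]
  have hinv : (g⁻¹ * x * g)⁻¹ = g⁻¹ * x⁻¹ * g := by group
  rw [hinv]

end Stabilizer

/-! ## §3 The cover: an element with `w`-integral characteristic polynomial stabilises a vertex -/

section Cover

variable {N : ℕ} (H' : Matrix (Fin N) (Fin N) L)

/-- **A FIXED VERTEX for every `δ ∈ U(H′)(L⁺_v)` whose characteristic polynomial is `w`-integral** (`H′` `c`-hermitian, `det H′ ≠ 0`): for every uniformiser `ϖ` of
`L_w` there is a frame `g` with `latt g` a vertex of the lattice tree of `(L_w^N, σ_w, H′_w)` and `e(δ)·latt g = latt g`.  (★ S-a FILE 2 at `K = L_w`.)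
[cite: BruhatTits1972, §10] [cite: Serre1980Trees, Ch. II §1.3] -/
theorem exists_isVertex_mapGL_localNonsplitEquiv_eq_of_charpoly (hH' : (H'.map (cmConjRingHom L))ᵀ = H') (hdet' : H'.det ≠ 0)
    {ϖ : w.1.adicCompletion L} (hϖ : Valued.v ϖ = WithZero.exp (-1 : ℤ)) (δ : (cmDatum L N H').Local v)
    (hδ : ∀ i, Valued.v ((((localNonsplitEquiv (IsCMField.complexConj L) H' (IsCMField.complexConj_ne_one L) w hw δ :
        ↥(unitaryGroupOfForm (galAdicCompletionMap (L := L) (IsCMField.complexConj L) hw) (placeForm H' w.1))) :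
          GL (Fin N) (w.1.adicCompletion L)) : Matrix (Fin N) (Fin N) (w.1.adicCompletion L)).charpoly.coeff i) ≤ 1) :
    ∃ g : GL (Fin N) (w.1.adicCompletion L),
      IsVertex (galAdicCompletionMap (L := L) (IsCMField.complexConj L) hw) ϖ (placeForm H' w.1) (latt (g : Matrix (Fin N) (Fin N) (w.1.adicCompletion L))) ∧
      mapGL ((localNonsplitEquiv (IsCMField.complexConj L) H' (IsCMField.complexConj_ne_one L) w hw δ :
          ↥(unitaryGroupOfForm (galAdicCompletionMap (L := L) (IsCMField.complexConj L) hw) (placeForm H' w.1))) :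
            GL (Fin N) (w.1.adicCompletion L)) (latt (g : Matrix (Fin N) (Fin N) (w.1.adicCompletion L))) =
        latt (g : Matrix (Fin N) (Fin N) (w.1.adicCompletion L)) := by
  haveI : IsPrincipalIdealRing 𝒪[w.1.adicCompletion L] := isPrincipalIdealRing_integer_adicCompletion L v w
  set u := (localNonsplitEquiv (IsCMField.complexConj L) H' (IsCMField.complexConj_ne_one L) w hw δ :
    ↥(unitaryGroupOfForm (galAdicCompletionMap (L := L) (IsCMField.complexConj L) hw) (placeForm H' w.1))) with hu
  obtain ⟨M, ⟨d, g, hMg, hG, hG', hdet⟩, hfix⟩ := exists_isVertex_mapGL_eq_of_charpoly (galAdicCompletionMap (L := L) (IsCMField.complexConj L) hw)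
    (galAdicCompletionMap_involutive L v w hw) (valued_galAdicCompletionMap L (IsCMField.complexConj L) hw) hϖ
    (isUnit_det_placeForm L v w H' hdet') (placeForm_map_transpose_of_hermitian L v w hw H' hH') u.2 hδ
  subst hMg
  exact ⟨g, ⟨d, g, rfl, hG, hG', hdet⟩, hfix⟩

/-- **THE VERTEX-STABILISER COVER of the integral-characteristic-polynomial locus of `U(H′)(L⁺_v)`**: every `δ` whose characteristic polynomial is `w`-integral lies
in a COMPACT OPEN subgroup `K` which is the stabiliser of a VERTEX lattice `latt g` (`u ∈ K ↔ e(u)·latt g = latt g`).  This is the open cover «SPAN» cuts a test function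
along. [cite: BruhatTits1972, §10] [cite: Rogawski1990, §4.9 Lemma 4.9.3 p. 56] -/
theorem exists_vertexStabilizer_mem_of_charpoly (hH' : (H'.map (cmConjRingHom L))ᵀ = H') (hdet' : H'.det ≠ 0)
    {ϖ : w.1.adicCompletion L} (hϖ : Valued.v ϖ = WithZero.exp (-1 : ℤ)) (δ : (cmDatum L N H').Local v)
    (hδ : ∀ i, Valued.v ((((localNonsplitEquiv (IsCMField.complexConj L) H' (IsCMField.complexConj_ne_one L) w hw δ :
        ↥(unitaryGroupOfForm (galAdicCompletionMap (L := L) (IsCMField.complexConj L) hw) (placeForm H' w.1))) :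
          GL (Fin N) (w.1.adicCompletion L)) : Matrix (Fin N) (Fin N) (w.1.adicCompletion L)).charpoly.coeff i) ≤ 1) :
    ∃ (g : GL (Fin N) (w.1.adicCompletion L)) (K : Subgroup ((cmDatum L N H').Local v)),
      IsVertex (galAdicCompletionMap (L := L) (IsCMField.complexConj L) hw) ϖ (placeForm H' w.1) (latt (g : Matrix (Fin N) (Fin N) (w.1.adicCompletion L))) ∧
      IsCompact (K : Set ((cmDatum L N H').Local v)) ∧ IsOpen (K : Set ((cmDatum L N H').Local v)) ∧
      (∀ u : (cmDatum L N H').Local v, u ∈ K ↔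
        mapGL ((localNonsplitEquiv (IsCMField.complexConj L) H' (IsCMField.complexConj_ne_one L) w hw u :
            ↥(unitaryGroupOfForm (galAdicCompletionMap (L := L) (IsCMField.complexConj L) hw) (placeForm H' w.1))) :
          GL (Fin N) (w.1.adicCompletion L)) (latt (g : Matrix (Fin N) (Fin N) (w.1.adicCompletion L))) =
          latt (g : Matrix (Fin N) (Fin N) (w.1.adicCompletion L))) ∧
      δ ∈ K := by
  obtain ⟨g, hg, hfix⟩ := exists_isVertex_mapGL_localNonsplitEquiv_eq_of_charpoly L v w hw H' hH' hdet' hϖ δ hδ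
  obtain ⟨K, hKc, hKo, hK⟩ := exists_vertexStabilizer L v w hw H' g
  exact ⟨g, K, hg, hKc, hKo, hK, (hK δ).2 hfix⟩

end Cover

end Literature.NumberTheory.Rogawski1990

end
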